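import Literature.MathematicalPhysics.QuantumFieldTheory.Balaban1983to89.B16Ineq382Case1
import Literature.MathematicalPhysics.QuantumFieldTheory.Balaban1983to89.B10Eq11Trace

/-!
# `Balaban1983to89.B16Ineq382WilsonFactor` — T. Bałaban, *Large field renormalization. II. Localization, exponentiation, and bounds for the 𝐑 operation*, Commun. Math. Phys. **122** (1989) 355–392 [Balaban1989LargeFieldII], p. 382, case 1 of the factor `1 − χ′`, last sentence: *"Then the Wilson action yields the factor exp(−¼(1/g_j²)(24R_j⁴)⁻²δ′_j²)"* — the Wilson-action mechanism at object level for `U(N)`-valued configurations, composed with PART 5's large plaquette and r13's arithmetic `prep382_case1_factor` (PART 6 of this unit's case-1 chain)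

statement-level skeleton of published theorems with citation tags; proofs where landed; nothing here is a claim about the Yang–Mills mass gap

PDF held: `paper:balaban1989-cmp122-large-field-ii` (journal page = PDF page + 354; pp. 381–382 = PDF pp. 27–28,
render `run/shared/lean/pub/pub-balaban/b2b-balaban-ref1/pages/1989-cmp122-large-field-II/…-p027-x2.png` re-read AS
AN IMAGE for this file (the three `exp(−¼(1/g²)·…)` displays of p. 381), `…-p028-x2.png` re-read by gen 3);
`paper:balaban1989-cmp122-large-field-i` = [IV] (p. 193 = PDF p. 19: *"|V_k(∂p′) − 1| > (O(1)B₃M²)⁻¹ε_k for some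
p′ ⊂ Z∩Λᶜ. This condition is enough to get the exponential small factor, estimating in the usual way the Wilson
action"*); `paper:balaban1987-cmp109-rg-i-small-field` = [I] ((0.2) p. 252: *"A^ε(U) = Σ_p ε^{d−4}[1 − Re tr U(∂p)]
… where tr is the normalized trace, i.e. tr 1 = 1"*, G ⊂ U(N) p. 252); `paper:balaban1985-cmp102-uv-stability-3d` (11)
p. 258 (the tree's `B10Eq11Trace`).

WHAT IS REPRODUCED (mega-formalization `lit-balaban`, HOME `run/shared/lean/pub/lit-balaban/`, Phase-2 seat p26,
generation 4; SKELETON row **B16.Lem@381** (r13: `B16Sect1Statements` §12 — `prep382_case1_factor` proves the printed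
equality/inequality `exp(−¼(1/g_j²)(24R_j⁴)⁻²δ′_j²) = exp(−A₁²48⁻²R_j⁻⁸p₁²(g_j)) ≦ exp(−R_j⁻⁸p₁²(g_j))`), referee
ref-5).  P. 382 (render p028), verbatim: *"This implies that at least one plaquette variable has to satisfy the
opposite inequality, i.e., |V″(∂p′) − 1| ≧ (24R_j⁴)⁻¹δ′_j for some p′ ⊂ Ω″^{~2}_{h+1}∖Ω″_{h+1}. Then the Wilson action
yields the factor exp(−¼(1/g_j²)(24R_j⁴)⁻²δ′_j²) = exp(−A₁²48⁻²R_j⁻⁸p₁²(g_j)) ≦ exp(−R_j⁻⁸p₁²(g_j))."*  PARTS 1–5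
(`B16Ineq382Stokes`, `…Cases`/`…TreeGauge`, `…VPrime`, `…AxialSlice`, `…Case1`) proved the large plaquette
(`Case1Setup.exists_large_plaquette`); this file supplies the last step, the passage from one large plaquette to the
exponential factor through the Wilson action.

THE TYPING / WHAT IS PROVED.  §1 (any `d`, `G = U(N) ⊂ M_N(ℂ)` with the operator norm = Mathlib's scoped `L2Operator`
matrix norm, the `|·|` of [Balaban1985Averaging] (19); configurations `Site d → Fin d → M_N(ℂ)ˣ` with values in
`B7Prop2Explicit.unitaryUnits`): `wilsonTerm V z κ ν = 1 − Re tr V(∂p)` (`tr = N⁻¹Tr`, the (0.2) [I] plaquette term for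
the plaquette `p = (z; κ, ν)` of the `ℤ^d` carrier) and `wilsonSum V S = Σ_{p∈S} wilsonTerm` over a finite set of
plaquette labels; PROVED: `sq_le_wilsonTerm` (`‖V(∂p) − 1‖² ≤ 2N·[1 − Re tr V(∂p)]`, = the tree's
`B10Eq11Trace.eq11_opNorm`), `wilsonTerm_nonneg`, `hol_plaqWord_swap` (`V(∂p)` for the reversed orientation is the
inverse), `norm_hol_swap_sub_one_le` (same deviation), `sq_le_wilsonSum` (one plaquette `p′ ∈ S` with `‖V(∂p′) − 1‖ ≥
θ ≥ 0` gives `(2N)⁻¹θ² ≤ Σ_S`), **`exp_wilsonSum_le`** (`exp(−g⁻²Σ_S[1 − Re tr V(∂p)]) ≤ exp(−(2N)⁻¹g⁻²θ²)`) and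
`exp_wilsonSum_le_quarter` (for `N ≤ 2` the printed constant `¼`).  §2 (p. 382 assembled on `M_N(ℂ)`):
**`Case1Setup.wilsonFactor_le`** — in PART 5's situation (`Case1Setup` + the hypotheses of
`Case1Setup.exists_large_plaquette`, `V′`, `V₀` unitary-valued), if some bond `b` of `P₁∖P₂` has `‖B′(b)‖ ≥ δ′_j` then
for EVERY finite set `S` of plaquette labels containing each plaquette with corners in `P₁∖P₂` in its increasing
orientation and every coupling `g > 0`: `exp(−g⁻²·wilsonSum V″ S) ≤ exp(−(2N)⁻¹g⁻²((24R_j⁴)⁻¹δ′_j)²)`, `V″ = V′V₀`;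
**`Case1Setup.wilsonFactor_le_printed`** (`N ≤ 2`: `≤ exp(−¼(1/g_j²)(24R_j⁴)⁻²δ′_j²)`, the printed display) and
**`Case1Setup.wilsonFactor_le_final`** (`≤ exp(−R_j⁻⁸p₁²(g_j))` via r13's `prep382_case1_factor` BY NAME, under
`δ′_j = g_jA₁p₁(g_j)` and `A₁ ≥ 48` = cell ledger R4; general `N`: `Case1Setup.wilsonFactor_le_final_N` under `1152·N ≤ A₁²`).
§3 the same mechanism for the factor of `1 − χ_{j,Λ}` (p. 381: *"The function 1 − χ_{j,Λ} yields the factor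
exp(−¼(1/g_j²)(O(1)B₃M²)⁻¹ε_j²) ≦ exp(−A₁²p₀²(g_j)), as it was proved in Sect. 1 [IV] after the definition (1.75)
[IV]"*; [IV] p. 193 quoted above): `exp_wilsonSum_le_chiΛ` (a plaquette with `‖V(∂p′) − 1‖ ≥ K⁻¹ε`, `K = O(1)B₃M²`,
gives `≤ exp(−(2N)⁻¹g⁻²(K²)⁻¹ε²)`), and `prep381_chiΛ_sq` = r13's `prep381_chiΛ` instantiated at `K²` (the comparison
`≦ exp(−A₁²p₀²(g_j))` under `4K²A₁² ≦ A₀²`) — see HONEST SCOPE (3).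

HONEST SCOPE / DEVIATIONS.  (1) MECHANISM-LEVEL MODEL of *"the Wilson action yields the factor"*: the action is read
as the (0.2) [I] plaquette action of the field `V″` itself over a finite plaquette set at a coupling `g` (`= g_j` in
the printed display); the print does not display which action/coupling/plaquette set carries the factor (in
[Balaban1985UV3] p. 273, (67)–(71), the analogous passage from a large AVERAGED plaquette to the fine Wilson action is
carried out explicitly — tree `B10Eq69Local`; that chain is not reproduced here).  (2) THE CONSTANT: in the operator-
norm reading of `|V″(∂p′) − 1|` (the reading of PARTS 1–5) one has `1 − Re tr U ≥ (2N)⁻¹|U − 1|²` for `U ∈ U(N)`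
(`B10Eq11Trace.eq11_opNorm`; cell DIVERGENCE D-b10.1), so the factor is `exp(−(2N)⁻¹g⁻²θ²)`; the printed `¼` is
`(2N)⁻¹` at `N = 2` and is dominated for `N ≤ 2` (`G ⊂ U(2)`, e.g. `SU(2)`); for `N ≥ 3` the printed `¼` would need the
normalized Hilbert–Schmidt reading of `|·|` ([I] (0.14), `B10Eq11Trace.eq11_normalized`), under which PARTS 1–5 are
not typed — recorded, not resolved, here (`Case1Setup.wilsonFactor_le_final_N` gives the final printed bound for every `N` under
`1152N ≤ A₁²`, which at `N = 2` is R4 `A₁ ≥ 48`).  (3) READING NOTE (cell GAPS.md G-B16-p26-02): [IV] p. 193 gives a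
plaquette with `|V_k(∂p′) − 1| > (O(1)B₃M²)⁻¹ε_k`, whose Wilson factor is `exp(−¼g⁻²(O(1)B₃M²)⁻²ε_k²)`; [V] p. 381
prints the exponent `(O(1)B₃M²)⁻¹` (first power).  Both are `O(1)`-type constants fixed before `A₀` (cell ledger R3
reads `A₀² ≧ 4·O(1)B₃M²·A₁²`; with the square it reads `A₀² ≧ 4(O(1)B₃M²)²A₁²`, equally admissible), so nothing
downstream changes; §3 proves the squared version and feeds r13's comparison at `K²`.  (4) As PARTS 1–5: one annulus
of `ℤ^{n+3}`, `≤`/`≥`-hypotheses where the print has strict inequalities, the (1.87) [IV] input and the p. 382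
smallness clauses as explicit hypotheses (listed in `B16Ineq382Case1`).  Every declaration is a definition with a body
or a proved theorem; nothing of [IV]/[V] is asserted as a hypothesis-free fact.  Unit `lit-balaban-p26`
(literature-prover-lit-balaban-p26-g4-0).
-/

noncomputable section

open scoped BigOperators

namespace Literature.MathematicalPhysics.QuantumFieldTheory.Balaban1983to89.B16Ineq382

open B7Prop1Explicit B7Prop2Explicit B8Lemma1NonAbelian B15TreeGauge196

/-! ## §1 The Wilson plaquette term for `U(N)`-valued configurations and the one-plaquette lower bound -/

section WilsonTerm

open scoped Matrix.Norms.L2Operator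

variable {d : ℕ} {N : ℕ}

/-- The plaquette term `1 − Re tr V(∂p)` of the Wilson action (0.2) [I] (`tr = N⁻¹Tr` the normalized trace, `tr 1 =
1`) for the plaquette `p = (z; κ, ν)` of the `ℤ^d` carrier and an `M_N(ℂ)ˣ`-valued configuration — the summand of
*"the Wilson action"* of p. 382. [cite: Balaban1989LargeFieldII, p.382 (before (1.77))] -/
def wilsonTerm (V : Site d → Fin d → (Matrix (Fin N) (Fin N) ℂ)ˣ) (z : Site d) (κ ν : Fin d) : ℝ :=
  1 - (N : ℝ)⁻¹ *
    (((hol V z (plaqWord κ ν) : (Matrix (Fin N) (Fin N) ℂ)ˣ) : Matrix (Fin N) (Fin N) ℂ)).trace.re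

/-- The Wilson action restricted to a finite set `S` of plaquette labels `(z, κ, ν)`: `Σ_{p∈S}[1 − Re tr V(∂p)]`
(the part of (0.2) [I] carrying the factor of p. 382). [cite: Balaban1989LargeFieldII, p.382 (before (1.77))] -/
def wilsonSum (V : Site d → Fin d → (Matrix (Fin N) (Fin N) ℂ)ˣ) (S : Finset (Site d × Fin d × Fin d)) : ℝ :=
  ∑ p ∈ S, wilsonTerm V p.1 p.2.1 p.2.2

variable {V : Site d → Fin d → (Matrix (Fin N) (Fin N) ℂ)ˣ}

/-- Unfolding lemma for `wilsonTerm`. [cite: Balaban1989LargeFieldII, p.382 (before (1.77))] -/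
theorem wilsonTerm_def (V : Site d → Fin d → (Matrix (Fin N) (Fin N) ℂ)ˣ) (z : Site d) (κ ν : Fin d) :
    wilsonTerm V z κ ν = 1 - (N : ℝ)⁻¹ *
      (((hol V z (plaqWord κ ν) : (Matrix (Fin N) (Fin N) ℂ)ˣ) : Matrix (Fin N) (Fin N) ℂ)).trace.re := rfl

variable [NeZero N]

/-- **The trace inequality behind "the Wilson action yields the factor"** (operator-norm reading): for a
`U(N)`-valued configuration, `‖V(∂p) − 1‖² ≤ 2N·[1 − Re tr V(∂p)]`, i.e. `1 − Re tr V(∂p) ≥ (2N)⁻¹‖V(∂p) − 1‖²`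
(the tree's `B10Eq11Trace.eq11_opNorm` = (11) of [Balaban1985UV3] in this reading). [cite: Balaban1989LargeFieldII, p.382 (before (1.77))] -/
theorem sq_le_wilsonTerm (hV : ∀ x κ, V x κ ∈ unitaryUnits (Matrix (Fin N) (Fin N) ℂ)) (z : Site d)
    (κ ν : Fin d) :
    ‖((hol V z (plaqWord κ ν) : (Matrix (Fin N) (Fin N) ℂ)ˣ) : Matrix (Fin N) (Fin N) ℂ) - 1‖ ^ 2 ≤
      2 * (N : ℝ) * wilsonTerm V z κ ν := by
  have hmem : ((hol V z (plaqWord κ ν) : (Matrix (Fin N) (Fin N) ℂ)ˣ) : Matrix (Fin N) (Fin N) ℂ) ∈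
      Matrix.unitaryGroup (Fin N) ℂ :=
    mem_unitaryUnits.mp (hol_mem_of hV z (plaqWord κ ν))
  have h := B10Eq11Trace.eq11_opNorm _ hmem
  rw [Fintype.card_fin] at h
  exact h

/-- Each Wilson term of a `U(N)`-valued configuration is nonnegative (`Re tr U ≤ 1`). [cite: Balaban1989LargeFieldII, p.382 (before (1.77))] -/
theorem wilsonTerm_nonneg (hV : ∀ x κ, V x κ ∈ unitaryUnits (Matrix (Fin N) (Fin N) ℂ)) (z : Site d)
    (κ ν : Fin d) : 0 ≤ wilsonTerm V z κ ν := by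
  have h := sq_le_wilsonTerm hV z κ ν
  have hN : (0 : ℝ) < N := by exact_mod_cast Nat.pos_of_ne_zero (NeZero.ne N)
  nlinarith [sq_nonneg ‖((hol V z (plaqWord κ ν) : (Matrix (Fin N) (Fin N) ℂ)ˣ) : Matrix (Fin N) (Fin N) ℂ) - 1‖]

/-- The Wilson sum of a `U(N)`-valued configuration is nonnegative. [cite: Balaban1989LargeFieldII, p.382 (before (1.77))] -/
theorem wilsonSum_nonneg (hV : ∀ x κ, V x κ ∈ unitaryUnits (Matrix (Fin N) (Fin N) ℂ))
    (S : Finset (Site d × Fin d × Fin d)) : 0 ≤ wilsonSum V S :=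
  Finset.sum_nonneg fun p _ => wilsonTerm_nonneg hV p.1 p.2.1 p.2.2

/-- **One large plaquette bounds the Wilson sum from below**: if `p′ = (z; κ, ν) ∈ S` has `‖V(∂p′) − 1‖ ≥ θ ≥ 0`
then `(2N)⁻¹θ² ≤ Σ_{p∈S}[1 − Re tr V(∂p)]` (all other terms are `≥ 0`). [cite: Balaban1989LargeFieldII, p.382 (before (1.77))] -/
theorem sq_le_wilsonSum (hV : ∀ x κ, V x κ ∈ unitaryUnits (Matrix (Fin N) (Fin N) ℂ))
    {S : Finset (Site d × Fin d × Fin d)} {z : Site d} {κ ν : Fin d} (hp : (z, κ, ν) ∈ S) {θ : ℝ} (hθ : 0 ≤ θ)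
    (hlarge : θ ≤ ‖((hol V z (plaqWord κ ν) : (Matrix (Fin N) (Fin N) ℂ)ˣ) : Matrix (Fin N) (Fin N) ℂ) - 1‖) :
    (2 * (N : ℝ))⁻¹ * θ ^ 2 ≤ wilsonSum V S := by
  have hN : (0 : ℝ) < N := by exact_mod_cast Nat.pos_of_ne_zero (NeZero.ne N)
  have h2N : (2 * (N : ℝ)) ≠ 0 := by positivity
  have h1 : θ ^ 2 ≤ 2 * (N : ℝ) * wilsonTerm V z κ ν :=
    (pow_le_pow_left₀ hθ hlarge 2).trans (sq_le_wilsonTerm hV z κ ν)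
  -- (`a` given explicitly: unifying `wilsonTerm V ?a.1 ?a.2.1 ?a.2.2` with `wilsonTerm V z κ ν` would unfold)
  have h2 : wilsonTerm V z κ ν ≤ wilsonSum V S := by
    have h := Finset.single_le_sum (f := fun p : Site d × Fin d × Fin d => wilsonTerm V p.1 p.2.1 p.2.2)
      (a := (z, κ, ν)) (fun p _ => wilsonTerm_nonneg hV p.1 p.2.1 p.2.2) hp
    exact h
  have h3 : (2 * (N : ℝ))⁻¹ * θ ^ 2 ≤ wilsonTerm V z κ ν :=
    calc (2 * (N : ℝ))⁻¹ * θ ^ 2 ≤ (2 * (N : ℝ))⁻¹ * (2 * (N : ℝ) * wilsonTerm V z κ ν) :=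
          mul_le_mul_of_nonneg_left h1 (by positivity)
      _ = wilsonTerm V z κ ν := inv_mul_cancel_left₀ h2N _
  exact h3.trans h2

/-- **"The Wilson action yields the factor"**, mechanism: a plaquette `p′ ∈ S` with `‖V(∂p′) − 1‖ ≥ θ ≥ 0` gives, for
every coupling `g > 0`, `exp(−g⁻²Σ_{p∈S}[1 − Re tr V(∂p)]) ≤ exp(−(2N)⁻¹(1/g²)θ²)` (operator-norm reading; the
printed constant is `¼`, see `exp_wilsonSum_le_quarter`). [cite: Balaban1989LargeFieldII, p.382 (before (1.77))] -/
theorem exp_wilsonSum_le (hV : ∀ x κ, V x κ ∈ unitaryUnits (Matrix (Fin N) (Fin N) ℂ))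
    {S : Finset (Site d × Fin d × Fin d)} {z : Site d} {κ ν : Fin d} (hp : (z, κ, ν) ∈ S) {θ : ℝ} (hθ : 0 ≤ θ)
    (hlarge : θ ≤ ‖((hol V z (plaqWord κ ν) : (Matrix (Fin N) (Fin N) ℂ)ˣ) : Matrix (Fin N) (Fin N) ℂ) - 1‖)
    {g : ℝ} (hg : 0 < g) :
    Real.exp (-(1 / g ^ 2 * wilsonSum V S)) ≤ Real.exp (-((2 * (N : ℝ))⁻¹ * (1 / g ^ 2) * θ ^ 2)) := by
  have h := sq_le_wilsonSum hV hp hθ hlarge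
  have hg2 : 0 < 1 / g ^ 2 := by positivity
  have h' : (2 * (N : ℝ))⁻¹ * (1 / g ^ 2) * θ ^ 2 ≤ 1 / g ^ 2 * wilsonSum V S := by
    have := mul_le_mul_of_nonneg_left h hg2.le
    linarith [this]
  exact Real.exp_le_exp.mpr (by linarith)

/-- **The printed constant `¼`**: for `N ≤ 2` (`G ⊂ U(2)`, e.g. `SU(2)`), `(2N)⁻¹ ≥ ¼`, so the factor is
`≤ exp(−¼(1/g²)θ²)`. [cite: Balaban1989LargeFieldII, p.382 (before (1.77))] -/
theorem exp_wilsonSum_le_quarter (hV : ∀ x κ, V x κ ∈ unitaryUnits (Matrix (Fin N) (Fin N) ℂ)) (hN : N ≤ 2)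
    {S : Finset (Site d × Fin d × Fin d)} {z : Site d} {κ ν : Fin d} (hp : (z, κ, ν) ∈ S) {θ : ℝ} (hθ : 0 ≤ θ)
    (hlarge : θ ≤ ‖((hol V z (plaqWord κ ν) : (Matrix (Fin N) (Fin N) ℂ)ˣ) : Matrix (Fin N) (Fin N) ℂ) - 1‖)
    {g : ℝ} (hg : 0 < g) :
    Real.exp (-(1 / g ^ 2 * wilsonSum V S)) ≤ Real.exp (-(1 / 4 * (1 / g ^ 2) * θ ^ 2)) := by
  refine (exp_wilsonSum_le hV hp hθ hlarge hg).trans (Real.exp_le_exp.mpr ?_)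
  have hN' : (N : ℝ) ≤ 2 := by exact_mod_cast hN
  have hN0 : (0 : ℝ) < N := by exact_mod_cast Nat.pos_of_ne_zero (NeZero.ne N)
  have hq : (1 : ℝ) / 4 ≤ (2 * (N : ℝ))⁻¹ := by
    rw [show (2 * (N : ℝ))⁻¹ = 1 / (2 * N) by ring, div_le_div_iff₀ (by norm_num) (by positivity)]
    linarith
  have hc : 0 ≤ 1 / g ^ 2 * θ ^ 2 := by positivity
  nlinarith [mul_le_mul_of_nonneg_right hq hc]

end WilsonTerm

/-! ### Orientation of the plaquette -/

section Orientation

variable {d : ℕ}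

/-- The plaquette traversed in the reversed orientation has the inverse holonomy: `V(∂p)` for `(z; ν, κ)` is
`(V(∂p))⁻¹` for `(z; κ, ν)` — the parallel-transport rule `U(−Γ) = U(Γ)⁻¹` of (9) [3] for the plaquette contour.
[cite: Balaban1985Averaging, (9) p.18] -/
theorem hol_plaqWord_swap {G : Type*} [Group G] (V : Site d → Fin d → G) (z : Site d) (κ ν : Fin d) :
    hol V z (plaqWord ν κ) = (hol V z (plaqWord κ ν))⁻¹ := by
  have h2 : z + e κ + e ν - e κ = z + e ν := by abel
  have h3 : z + e κ + e ν + -e κ - e ν = z := by abel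
  have h2' : z + e ν + e κ - e ν = z + e κ := by abel
  have h3' : z + e ν + e κ + -e ν - e κ = z := by abel
  simp only [plaqWord, hol_cons, hol_nil, mul_one, stepHol_true, stepHol_false, Letter.vec_true,
    Letter.vec_false, h2, h3, h2', h3', mul_inv_rev, inv_inv, mul_assoc]

variable {𝔸 : Type*} [NormedRing 𝔸] [NormOneClass 𝔸]

/-- For a `U1`-valued configuration the two orientations of a plaquette deviate from `1` by the same amount:
`‖V(∂p)⁻¹ − 1‖ ≤ ‖V(∂p) − 1‖` both ways ((9) and the norm rule (19) of [3]). [cite: Balaban1985Averaging, (9) p.18] -/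
theorem norm_hol_swap_sub_one_le {V : Site d → Fin d → 𝔸ˣ} (hV : ∀ x κ, V x κ ∈ U1 𝔸) (z : Site d)
    (κ ν : Fin d) :
    ‖((hol V z (plaqWord κ ν) : 𝔸ˣ) : 𝔸) - 1‖ ≤ ‖((hol V z (plaqWord ν κ) : 𝔸ˣ) : 𝔸) - 1‖ := by
  rw [hol_plaqWord_swap V z ν κ]
  exact norm_inv_sub_one_le (hol_mem hV _ _)

end Orientation

/-! ## §2 P. 382, case 1: the Wilson factor, assembled on `M_N(ℂ)` -/

section Case1Wilson

open scoped Matrix.Norms.L2Operator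
open NormedSpace

/-- `V″ = V′V₀` is `U(N)`-valued when `V′`, `V₀` are. [cite: Balaban1989LargeFieldI, (1.81) p.195] -/
theorem mulCfg_mem_unitaryUnits {d : ℕ} {𝔹 : Type*} [Monoid 𝔹] [StarMul 𝔹] {V' V₀ : Site d → Fin d → 𝔹ˣ}
    (hV' : ∀ x κ, V' x κ ∈ unitaryUnits 𝔹) (hV₀ : ∀ x κ, V₀ x κ ∈ unitaryUnits 𝔹) (x : Site d) (κ : Fin d) :
    mulCfg V' V₀ x κ ∈ unitaryUnits 𝔹 :=
  (unitaryUnits 𝔹).mul_mem (hV' x κ) (hV₀ x κ)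

variable {n : ℕ} {N : ℕ} [NeZero N]
variable {lo hi lo' hi' : Site (n + 3)} {τ : ℤ} {W : ℕ}
  {V' V₀ : Site (n + 3) → Fin (n + 3) → (Matrix (Fin N) (Fin N) ℂ)ˣ} {η : ℝ}
  {M R' L Rj β₀ K A₀ A₁ B₃ B₅ p₀g p₁g Linv εj δ'j : ℝ} {N' : ℕ}

/-! The standing hypotheses of PART 5's `Case1Setup.exists_large_plaquette`, declared once for the three theorems
below (PART 5's situation `Case1Setup`; `V′`, `V₀` unitary-valued; `V′(b) = e^{B′(b)}`, `‖B′(b)‖ ≤ 1/2` on the bonds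
of `P₁∖P₂` ([IV] p. 196 regularity); sides `≤ 100MR′` sites, `d ≤ 100MR′` (condition (i) of [IV]); `R′ ≤ (L +
1)R_j^{1+β₀}`; the (1.87) [IV] input `η ≤ K·B₃²B₅M⁶(L⁻¹)^{N′}ε_j`; `ε_j = (A₀/A₁)(p₀/p₁)δ′_j`; the p. 382 smallness
clauses; a bond `b = ⟨x, x + e_μ⟩` of `P₁∖P₂` with `‖B′(b)‖ ≥ δ′_j` = the restriction of `1 − χ′`, case 1; a finite
set `S` of plaquette labels containing every plaquette `(z; κ, ν)`, `κ < ν`, with its four corners in `P₁∖P₂`). -/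
variable (H : Case1Setup lo hi lo' hi' τ W V' V₀ η)
  (hV' : ∀ x κ, V' x κ ∈ unitaryUnits (Matrix (Fin N) (Fin N) ℂ))
  (hV₀ : ∀ x κ, V₀ x κ ∈ unitaryUnits (Matrix (Fin N) (Fin N) ℂ))
  (B' : Site (n + 3) → Fin (n + 3) → Matrix (Fin N) (Fin N) ℂ)
  (hexp : ∀ x μ, x ∈ ann lo hi lo' hi' → x + e μ ∈ ann lo hi lo' hi' →
    ((V' x μ : (Matrix (Fin N) (Fin N) ℂ)ˣ) : Matrix (Fin N) (Fin N) ℂ) = exp (B' x μ))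
  (hBsmall : ∀ x μ, x ∈ ann lo hi lo' hi' → x + e μ ∈ ann lo hi lo' hi' → ‖B' x μ‖ ≤ 1 / 2)
  (hD : (W : ℝ) + 1 ≤ 100 * M * R') (hd : (n : ℝ) + 3 ≤ 100 * M * R') (hM : 0 ≤ M)
  (hRj : R' ≤ (L + 1) * Rj ^ (1 + β₀)) (hRj0 : 0 < Rj) (hδ : 0 < δ'j)
  (hη : η ≤ K * B₃ ^ 2 * B₅ * M ^ 6 * Linv ^ N' * εj) (hεj : εj = A₀ / A₁ * (p₀g / p₁g) * δ'j)
  (hsmall : 100 * (2 * ((n : ℝ) + 4) + 1) * (L + 1) * K * (A₀ / A₁) * B₃ ^ 2 * B₅ * M ^ 7 * Rj ^ (1 + β₀) *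
    (p₀g / p₁g) * Linv ^ N' ≤ 1 / 4)
  (hR4 : (100 * M * (L + 1) * Rj ^ (1 + β₀)) ^ 2 ≤ Rj ^ 4)
  {x : Site (n + 3)} {μ : Fin (n + 3)} (hx : x ∈ ann lo hi lo' hi') (hx' : x + e μ ∈ ann lo hi lo' hi')
  (hb : δ'j ≤ ‖B' x μ‖)
  (S : Finset (Site (n + 3) × Fin (n + 3) × Fin (n + 3)))
  (hS : ∀ (z : Site (n + 3)) (κ ν : Fin (n + 3)), κ < ν → z ∈ ann lo hi lo' hi' → z + e κ ∈ ann lo hi lo' hi' →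
    z + e ν ∈ ann lo hi lo' hi' → z + e κ + e ν ∈ ann lo hi lo' hi' → (z, κ, ν) ∈ S)

include H hV' hV₀ hexp hBsmall hD hd hM hRj hRj0 hδ hη hεj hsmall hR4 hx hx' hb hS

/-- **p. 382, case 1: "Then the Wilson action yields the factor …", object level on `M_N(ℂ)`** (operator norm): under
the standing hypotheses above, for every coupling `g > 0`:
`exp(−g⁻²Σ_{p∈S}[1 − Re tr V″(∂p)]) ≤ exp(−(2N)⁻¹(1/g²)((24R_j⁴)⁻¹δ′_j)²)`, `V″ = V′V₀` — PART 5's large plaquette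
(`Case1Setup.exists_large_plaquette`), put in increasing orientation (`norm_hol_swap_sub_one_le`), fed to
`exp_wilsonSum_le`. [cite: Balaban1989LargeFieldII, p.382 (before (1.77))] -/
theorem Case1Setup.wilsonFactor_le {g : ℝ} (hg : 0 < g) :
    Real.exp (-(1 / g ^ 2 * wilsonSum (mulCfg V' V₀) S)) ≤
      Real.exp (-((2 * (N : ℝ))⁻¹ * (1 / g ^ 2) * ((24 * Rj ^ 4)⁻¹ * δ'j) ^ 2)) := by
  letI : CStarAlgebra (Matrix (Fin N) (Fin N) ℂ) := {}
  -- PART 5: a large plaquette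
  obtain ⟨z, κ, ν, hκν, h1, h2, h3, h4, hlarge⟩ :=
    H.exists_large_plaquette B' hexp hBsmall hD hd hM hRj hRj0 hδ hη hεj hsmall hR4 hx hx' hb
  have hVV : ∀ x κ, mulCfg V' V₀ x κ ∈ unitaryUnits (Matrix (Fin N) (Fin N) ℂ) := mulCfg_mem_unitaryUnits hV' hV₀
  have hVU : ∀ x κ, mulCfg V' V₀ x κ ∈ U1 (Matrix (Fin N) (Fin N) ℂ) := fun x κ => unitaryUnits_le_U1 (hVV x κ)
  have hθ : 0 ≤ (24 * Rj ^ 4)⁻¹ * δ'j := by positivity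
  -- orientation: put the plaquette in increasing orientation
  rcases lt_or_gt_of_ne hκν with hlt | hgt
  · exact exp_wilsonSum_le hVV (hS z κ ν hlt h1 h2 h3 h4) hθ hlarge.le hg
  · have hlarge' : (24 * Rj ^ 4)⁻¹ * δ'j ≤
        ‖((hol (mulCfg V' V₀) z (plaqWord ν κ) : (Matrix (Fin N) (Fin N) ℂ)ˣ) : Matrix (Fin N) (Fin N) ℂ) - 1‖ :=
      hlarge.le.trans (norm_hol_swap_sub_one_le hVU z κ ν)
    have h4' : z + e ν + e κ ∈ ann lo hi lo' hi' := by rwa [add_right_comm]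
    exact exp_wilsonSum_le hVV (hS z ν κ hgt h1 h3 h2 h4') hθ hlarge' hg

/-- **p. 382, the printed display**: for `N ≤ 2` (`G ⊂ U(2)`, e.g. `SU(2)`) and the coupling `g_j`: *"Then the
Wilson action yields the factor exp(−¼(1/g_j²)(24R_j⁴)⁻²δ′_j²)"* — `exp(−g_j⁻²Σ_{p∈S}[1 − Re tr V″(∂p)]) ≤
exp(−¼(1/g_j²)((24R_j⁴)²)⁻¹δ′_j²)`, the left-hand side of r13's `B16Sect1Statements.prep382_case1_factor`.
[cite: Balaban1989LargeFieldII, p.382 (before (1.77))] -/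
theorem Case1Setup.wilsonFactor_le_printed (hN : N ≤ 2) {gj : ℝ} (hgj : 0 < gj) :
    Real.exp (-(1 / gj ^ 2 * wilsonSum (mulCfg V' V₀) S)) ≤
      Real.exp (-(1 / 4 * (1 / gj ^ 2) * ((24 * Rj ^ 4) ^ 2)⁻¹ * δ'j ^ 2)) := by
  have h := H.wilsonFactor_le hV' hV₀ B' hexp hBsmall hD hd hM hRj hRj0 hδ hη hεj hsmall hR4 hx hx' hb S hS hgj
  refine h.trans (Real.exp_le_exp.mpr ?_)
  have hN' : (N : ℝ) ≤ 2 := by exact_mod_cast hN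
  have hN0 : (0 : ℝ) < N := by exact_mod_cast Nat.pos_of_ne_zero (NeZero.ne N)
  have hq : (1 : ℝ) / 4 ≤ (2 * (N : ℝ))⁻¹ := by
    rw [show (2 * (N : ℝ))⁻¹ = 1 / (2 * N) by ring, div_le_div_iff₀ (by norm_num) (by positivity)]
    linarith
  have hR : ((24 * Rj ^ 4)⁻¹ * δ'j) ^ 2 = ((24 * Rj ^ 4) ^ 2)⁻¹ * δ'j ^ 2 := by rw [mul_pow, inv_pow]
  have hc : 0 ≤ 1 / gj ^ 2 * (((24 * Rj ^ 4) ^ 2)⁻¹ * δ'j ^ 2) := by positivity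
  rw [hR] at h ⊢
  nlinarith [mul_le_mul_of_nonneg_right hq hc]

/-- **p. 382, the final printed bound**: for `N ≤ 2`, with `δ′_j = g_jA₁p₁(g_j)` ([III] (2.3)) and `A₁ ≥ 48` (cell
ledger R4), the Wilson factor is `≤ exp(−R_j⁻⁸p₁²(g_j))` — r13's `B16Sect1Statements.prep382_case1_factor` BY NAME on
top of `wilsonFactor_le_printed`: *"= exp(−A₁²48⁻²R_j⁻⁸p₁²(g_j)) ≦ exp(−R_j⁻⁸p₁²(g_j))"*. [cite: Balaban1989LargeFieldII, p.382 (before (1.77))] -/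
theorem Case1Setup.wilsonFactor_le_final (hN : N ≤ 2) {gj p₁gj : ℝ} (hgj : 0 < gj) (hδA : δ'j = gj * A₁ * p₁gj)
    (hA₁ : 48 ≤ A₁) :
    Real.exp (-(1 / gj ^ 2 * wilsonSum (mulCfg V' V₀) S)) ≤ Real.exp (-((Rj ^ 8)⁻¹ * p₁gj ^ 2)) := by
  have h := H.wilsonFactor_le_printed hV' hV₀ B' hexp hBsmall hD hd hM hRj hRj0 hδ hη hεj hsmall hR4 hx hx' hb S hS
    hN hgj
  obtain ⟨heq, hle⟩ := B16Sect1Statements.prep382_case1_factor (Rj := Rj) hgj.ne' hRj0.ne' hδA hA₁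
  exact h.trans (heq.le.trans hle)

/-- **The final bound for every `N`** (operator-norm constant `(2N)⁻¹` in place of the printed `¼`): with
`δ′_j = g_jA₁p₁(g_j)` and `1152·N ≤ A₁²` (at `N = 2` this is R4 `A₁ ≥ 48`), the Wilson factor is
`≤ exp(−R_j⁻⁸p₁²(g_j))`. [cite: Balaban1989LargeFieldII, p.382 (before (1.77))] -/
theorem Case1Setup.wilsonFactor_le_final_N {gj p₁gj : ℝ} (hgj : 0 < gj) (hδA : δ'j = gj * A₁ * p₁gj)
    (hA₁ : 1152 * (N : ℝ) ≤ A₁ ^ 2) :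
    Real.exp (-(1 / gj ^ 2 * wilsonSum (mulCfg V' V₀) S)) ≤ Real.exp (-((Rj ^ 8)⁻¹ * p₁gj ^ 2)) := by
  have h := H.wilsonFactor_le hV' hV₀ B' hexp hBsmall hD hd hM hRj hRj0 hδ hη hεj hsmall hR4 hx hx' hb S hS hgj
  refine h.trans (Real.exp_le_exp.mpr ?_)
  have hN0 : (0 : ℝ) < N := by exact_mod_cast Nat.pos_of_ne_zero (NeZero.ne N)
  have hR8 : 0 < (Rj ^ 8)⁻¹ := inv_pos.mpr (by positivity)
  -- the exponent equals `A₁²/(1152N)·R_j⁻⁸p₁²`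
  have e1 : (2 * (N : ℝ))⁻¹ * (1 / gj ^ 2) * ((24 * Rj ^ 4)⁻¹ * δ'j) ^ 2 =
      A₁ ^ 2 / (1152 * N) * ((Rj ^ 8)⁻¹ * p₁gj ^ 2) := by
    subst hδA
    have hR4' : Rj ^ 4 ≠ 0 := pow_ne_zero 4 hRj0.ne'
    field_simp
    ring
  have key : (1 : ℝ) ≤ A₁ ^ 2 / (1152 * N) := by
    rw [le_div_iff₀ (by positivity)]
    linarith
  have hc : 0 ≤ (Rj ^ 8)⁻¹ * p₁gj ^ 2 := by positivity
  rw [e1]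
  nlinarith [mul_le_mul_of_nonneg_right key hc]

end Case1Wilson

/-! ## §3 The same mechanism for the factor of `1 − χ_{j,Λ}` ([IV] p. 193, [V] p. 381) -/

section ChiLambda

open scoped Matrix.Norms.L2Operator

variable {d : ℕ} {N : ℕ} [NeZero N] {V : Site d → Fin d → (Matrix (Fin N) (Fin N) ℂ)ˣ}

/-- **[IV] p. 193: "|V_k(∂p′) − 1| > (O(1)B₃M²)⁻¹ε_k for some p′ ⊂ Z∩Λᶜ. This condition is enough to get the
exponential small factor, estimating in the usual way the Wilson action"** — object level on `M_N(ℂ)` (operator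
norm): a plaquette `p′ ∈ S` with `‖V(∂p′) − 1‖ ≥ K⁻¹ε` (`K = O(1)B₃M² > 0`, `ε ≥ 0`) gives, for every coupling
`g > 0`, `exp(−g⁻²Σ_{p∈S}[1 − Re tr V(∂p)]) ≤ exp(−(2N)⁻¹(1/g²)(K²)⁻¹ε²)` (the printed constant `¼` for `N ≤ 2` by
`exp_wilsonSum_le_quarter`; the square on `K`: HONEST SCOPE (3)). [cite: Balaban1989LargeFieldI, p.193 (mechanism of 1 − χ_{k,Λ})] -/
theorem exp_wilsonSum_le_chiΛ (hV : ∀ x κ, V x κ ∈ unitaryUnits (Matrix (Fin N) (Fin N) ℂ))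
    {S : Finset (Site d × Fin d × Fin d)} {z : Site d} {κ ν : Fin d} (hp : (z, κ, ν) ∈ S) {K ε : ℝ} (hK : 0 < K)
    (hε : 0 ≤ ε)
    (hlarge : K⁻¹ * ε ≤ ‖((hol V z (plaqWord κ ν) : (Matrix (Fin N) (Fin N) ℂ)ˣ) : Matrix (Fin N) (Fin N) ℂ) - 1‖)
    {g : ℝ} (hg : 0 < g) :
    Real.exp (-(1 / g ^ 2 * wilsonSum V S)) ≤ Real.exp (-((2 * (N : ℝ))⁻¹ * (1 / g ^ 2) * (K ^ 2)⁻¹ * ε ^ 2)) := by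
  have hθ : 0 ≤ K⁻¹ * ε := by positivity
  have h := exp_wilsonSum_le hV hp hθ hlarge hg
  have e : (K⁻¹ * ε) ^ 2 = (K ^ 2)⁻¹ * ε ^ 2 := by rw [mul_pow, inv_pow]
  rw [e, ← mul_assoc] at h
  exact h

/-- **[V] p. 381, the comparison for the factor of `1 − χ_{j,Λ}` with the squared constant**: r13's
`B16Sect1Statements.prep381_chiΛ` instantiated at `K²` — `exp(−¼(1/g_j²)(K²)⁻¹ε_j²) ≦ exp(−A₁²p₀²(g_j))` under
`ε_j = g_jA₀p₀(g_j)` and `4K²A₁² ≦ A₀²` (cell ledger R3 read with the square; HONEST SCOPE (3)). [cite: Balaban1989LargeFieldII, p.381 (after (1.76))] -/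
theorem prep381_chiΛ_sq {gj K εj A₀ p₀gj A₁ : ℝ} (hgj : gj ≠ 0) (hK : 0 < K) (hε : εj = gj * A₀ * p₀gj)
    (hR3 : 4 * K ^ 2 * A₁ ^ 2 ≤ A₀ ^ 2) :
    Real.exp (-(1 / 4 * (1 / gj ^ 2) * (K ^ 2)⁻¹ * εj ^ 2)) ≤ Real.exp (-(A₁ ^ 2 * p₀gj ^ 2)) :=
  B16Sect1Statements.prep381_chiΛ hgj (by positivity) hε hR3

end ChiLambda

end Literature.MathematicalPhysics.QuantumFieldTheory.Balaban1983to89.B16Ineq382
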